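import Summits.Ventures.HodgeRepro2.Dictionary
import Summits.Ventures.HodgeRepro2.Incoherent
import Summits.Ventures.HodgeRepro2.Signs

/-!
# Bridge.lean — the two independent formalisations (p1 and p2) agree on CM types and signs

Seat p1 (gen 2) of the blind cell pub-hodge-repro2.  The cell's kernel annex was written twice,
independently: seat p1 (namespace `Summit.Ventures.HodgeRepro2`) models a CM type as a SET of
embeddings (`IsCMType`, Defs.lean) and uses Shimura's sign convention `−i τ(δ) > 0`
(`cmTypeOfImaginary`, Dictionary.lean, Shimura 1979 (4.2)); seat p2 (namespace
`…HodgeRepro2.ShimuraData`) models a CM type as a CHOICE FUNCTION on the infinite places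
(`ShimuraData.CMTypeChoice`, Hypothesis.lean) and uses Liu's convention `Im τ′(e) < 0`
(`ShimuraData.cmTypeOfImaginary`, Incoherent.lean, Liu Def. 4.12).  LEAN-ANNEX-p1 §7–§8 states in
prose that the two agree up to `e = −δ`.  This file proves it:

* `shimuraData_cmTypeOfImaginary_eq_neg`: `ShimuraData.cmTypeOfImaginary K e = cmTypeOfImaginary K (−e)`
  for every `e` (Liu's `e` is Shimura's `−δ`);
* `isCMType_range_emb`: the range of a p2 choice function is a p1 CM type;
* `cmTypeChoiceOfIsCMType`: a p1 CM type yields a p2 choice function with that range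
  (`range_emb_cmTypeChoiceOfIsCMType`);
* `exists_liu_sign_of_isCMType`: p2's sign-element existence theorem
  (`ShimuraData.exists_imaginary_of_cmTypeChoice`) restated for p1 CM types.
-/

namespace Summit.Ventures.HodgeRepro2

open NumberField

section Signs

variable (K : Type*) [Field K]

/-- **Liu's `e` is Shimura's `−δ`**: p2's `{τ | Im τ(e) < 0}` is p1's `{τ | −i τ(−e) > 0}`. -/
theorem shimuraData_cmTypeOfImaginary_eq_neg (e : K) :
    ShimuraData.cmTypeOfImaginary K e = Summit.Ventures.HodgeRepro2.cmTypeOfImaginary K (-e) := by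
  ext τ
  simp only [ShimuraData.cmTypeOfImaginary, Summit.Ventures.HodgeRepro2.cmTypeOfImaginary,
    Set.mem_setOf_eq, map_neg, neg_mul, mul_neg, neg_neg, Complex.mul_re, Complex.I_re,
    Complex.I_im, zero_mul, one_mul, zero_sub]
  constructor <;> intro h <;> linarith

end Signs

section CMTypes

variable (K : Type*) [Field K] [NumberField K] [IsCMField K]

/-- The range of a p2 choice function (one embedding above each infinite place) is a p1 CM type:
of each conjugate pair exactly one member is chosen. -/
theorem isCMType_range_emb (Φ : ShimuraData.CMTypeChoice K) : IsCMType K (Set.range Φ.emb) := by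
  intro φ
  have hconj : InfinitePlace.mk (ComplexEmbedding.conjugate φ) = InfinitePlace.mk φ :=
    InfinitePlace.mk_conjugate_eq φ
  have hne : ComplexEmbedding.conjugate φ ≠ φ := fun h =>
    IsTotallyComplex.complexEmbedding_not_isReal φ (ComplexEmbedding.isReal_iff.mpr h)
  -- the embedding chosen above the place of `φ` is `φ` or its conjugate
  have hmem := Φ.emb_mk (InfinitePlace.mk φ)
  rcases InfinitePlace.mk_eq_iff.mp hmem with h | h
  · -- chosen `φ`: then the conjugate is not chosen
    left
    refine ⟨⟨_, h⟩, ?_⟩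
    rintro ⟨w, hw⟩
    have hw' : w = InfinitePlace.mk φ := by
      rw [← Φ.emb_mk w, hw, hconj]
    rw [hw', h] at hw
    exact hne hw.symm
  · -- chosen the conjugate: then `φ` is not chosen
    right
    have h' : Φ.emb (InfinitePlace.mk φ) = ComplexEmbedding.conjugate φ := by
      have := congrArg ComplexEmbedding.conjugate h
      rwa [ComplexEmbedding.involutive_conjugate K (Φ.emb _)] at this
    refine ⟨⟨_, h'⟩, ?_⟩
    rintro ⟨w, hw⟩
    have hw' : w = InfinitePlace.mk φ := by rw [← Φ.emb_mk w, hw]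
    rw [hw'] at hw
    rw [hw] at h
    exact hne h

omit [NumberField K] [IsCMField K] in
/-- Above every infinite place a p1 CM type contains exactly one embedding; this chooses it. -/
theorem exists_mem_mk_eq {Φ : Set (K →+* ℂ)} (hΦ : IsCMType K Φ) (w : InfinitePlace K) :
    ∃ φ ∈ Φ, InfinitePlace.mk φ = w := by
  rcases hΦ w.embedding with ⟨h, _⟩ | ⟨h, _⟩
  · exact ⟨_, h, InfinitePlace.mk_embedding w⟩
  · exact ⟨_, h, by rw [InfinitePlace.mk_conjugate_eq, InfinitePlace.mk_embedding]⟩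

/-- A p1 CM type as a p2 choice function. -/
noncomputable def cmTypeChoiceOfIsCMType {Φ : Set (K →+* ℂ)} (hΦ : IsCMType K Φ) :
    ShimuraData.CMTypeChoice K where
  emb w := (exists_mem_mk_eq K hΦ w).choose
  emb_mk w := (exists_mem_mk_eq K hΦ w).choose_spec.2

omit [NumberField K] [IsCMField K] in
/-- The choice function built from a p1 CM type has exactly that type as its range. -/
theorem range_emb_cmTypeChoiceOfIsCMType {Φ : Set (K →+* ℂ)} (hΦ : IsCMType K Φ) :
    Set.range (cmTypeChoiceOfIsCMType K hΦ).emb = Φ := by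
  ext φ
  constructor
  · rintro ⟨w, rfl⟩
    exact (exists_mem_mk_eq K hΦ w).choose_spec.1
  · intro hφ
    refine ⟨InfinitePlace.mk φ, ?_⟩
    -- the chosen embedding above `mk φ` lies in `Φ` and is `φ` or its conjugate; not the conjugate
    have h1 := (exists_mem_mk_eq K hΦ (InfinitePlace.mk φ)).choose_spec.1
    have h2 := (exists_mem_mk_eq K hΦ (InfinitePlace.mk φ)).choose_spec.2
    rcases InfinitePlace.mk_eq_iff.mp h2 with h | h
    · exact h
    · exfalso
      have hch : (exists_mem_mk_eq K hΦ (InfinitePlace.mk φ)).choose =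
          ComplexEmbedding.conjugate φ := by
        have := congrArg ComplexEmbedding.conjugate h
        rwa [ComplexEmbedding.involutive_conjugate K _] at this
      rw [hch] at h1
      rcases hΦ φ with ⟨_, hc⟩ | ⟨_, hc⟩
      · exact hc h1
      · exact hc hφ

/-- p2's sign-element existence (`ShimuraData.exists_imaginary_of_cmTypeChoice`, weak
approximation) read on a p1 CM type: there is `e ≠ 0` with `ē = −e` and `Im τ′(e) < 0` for all
`τ′ ∈ Φ` — Liu Def. 4.12. -/
theorem exists_liu_sign_of_isCMType {Φ : Set (K →+* ℂ)} (hΦ : IsCMType K Φ) :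
    ∃ e : K, (ShimuraData.ρ K) e = -e ∧ e ≠ 0 ∧ ∀ τ' ∈ Φ, (τ' e).im < 0 := by
  obtain ⟨e, h1, h2, h3⟩ :=
    ShimuraData.exists_imaginary_of_cmTypeChoice K (cmTypeChoiceOfIsCMType K hΦ)
  refine ⟨e, h1, h2, fun τ' hτ' => ?_⟩
  rw [← range_emb_cmTypeChoiceOfIsCMType K hΦ] at hτ'
  obtain ⟨w, rfl⟩ := hτ'
  exact h3 w

end CMTypes

end Summit.Ventures.HodgeRepro2
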